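import Summits.CriticalPhenomena.Ising3DConformalLimit.Theorems.HarmonicMomentsIsotropyDilutionTransferNuB1
import Summits.CriticalPhenomena.Ising3DConformalLimit.Theorems.HarmonicMomentsIsotropyDilutionTransferFischer
import Summits.CriticalPhenomena.Ising3DConformalLimit.Theorems.HarmonicMomentsIsotropyDilutionTransferDeterminacy
import Summits.CriticalPhenomena.Ising3DConformalLimit.Theorems.HarmonicMomentsIsotropyDilutionTransferWeakLimit

/-!
# Asymptotic `O(3)`-invariance of the scaled subcritical two-point measures

Support file for item `DilutionTransfer` (stmt-CriticalPhenomena-6037) of route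
`HarmonicMomentsIsotropy` (sub-problem `Ising3DConformalLimit`).

* `inner_moments_radial` — vanishing harmonic moments make the marginal moments `∫ ⟪y,ξ⟫ᵏ` radial
  (Fischer decomposition of `(ξ·y)ᵏ`);
* `growth_bounds`, `integrable_poly_of_exp_moment` — polynomial moments under an exponential moment;
* `asymptotic_invariance` — **harmonic dilution + CLW (ii) ⇒ `∫ ψ∘T dν_β - ∫ ψ dν_β → 0` as
  `β ↑ β_c`** for bounded continuous `ψ` and linear isometries `T` (Prokhorov subsequences, moment
  convergence, moment determinacy).
-/

noncomputable section

open MeasureTheory Filter Topology Set MvPolynomial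
open scoped ENNReal NNReal BigOperators RealInnerProductSpace BoundedContinuousFunction
open Literature.Probability.LatticeModels

namespace Summit.CriticalPhenomena.Ising3DConformalLimit.Theorems.HarmonicMomentsIsotropy

/-! ## Radial marginal moments from vanishing harmonic moments -/

/-- The inner product with `ξ` is the evaluation of the linear form `∑ ξᵢ Xᵢ`. -/
theorem inner_eq_eval_linForm (y ξ : V) :
    ⟪y, ξ⟫ = eval (fun i => y i) (∑ i : Fin 3, C (ξ i) * X i) := by
  simp [PiLp.inner_apply, map_sum, mul_comm]

/-- `∑ yᵢ² = ‖y‖²` on Euclidean `ℝ³`. -/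
theorem eval_rsq (y : V) :
    eval (fun i => y i) (∑ i : Fin 3, (X i : MvPolynomial (Fin 3) ℝ) ^ 2) = ‖y‖ ^ 2 := by
  rw [EuclideanSpace.norm_sq_eq]
  simp [map_sum]

/-- **Vanishing harmonic moments make the marginal moments radial.** If a finite measure `μ` on
Euclidean `ℝ³` integrates every `‖y‖^{2m} Y(y)` (`Y` harmonic homogeneous of degree `≥ 1`) to zero
and integrates `‖y‖^{2j} P(y)` for homogeneous `P`, then `∫ ⟪y, ξ⟫ᵏ dμ` depends on `ξ` only
through `‖ξ‖` (Fischer decomposition of `(ξ·y)ᵏ`, `harmonic_decomposition_linear_pow`). -/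
theorem inner_moments_radial {μ : Measure V} [IsFiniteMeasure μ]
    (hint : ∀ (P : MvPolynomial (Fin 3) ℝ) (n j : ℕ), P.IsHomogeneous n →
      Integrable (fun y : V => ‖y‖ ^ (2 * j) * eval (fun i => y i) P) μ)
    (hharm : ∀ (n m : ℕ) (Y : MvPolynomial (Fin 3) ℝ), 1 ≤ n → Y.IsHomogeneous n →
      (∑ i : Fin 3, pderiv i (pderiv i Y)) = 0 →
      ∫ y, ‖y‖ ^ (2 * m) * eval (fun i => y i) Y ∂μ = 0)
    (ξ ξ' : V) (hξ : ‖ξ‖ = ‖ξ'‖) (k : ℕ) :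
    ∫ y, ⟪y, ξ⟫ ^ k ∂μ = ∫ y, ⟪y, ξ'⟫ ^ k ∂μ := by
  obtain ⟨e, he⟩ := Fischer.harmonic_decomposition_linear_pow k
  -- the common value
  have hval : ∀ ζ : V, ∫ y, ⟪y, ζ⟫ ^ k ∂μ = ∑ j ∈ Finset.range (k / 2 + 1),
      (if 2 * j = k then e * (‖ζ‖ ^ 2) ^ j * ∫ y, ‖y‖ ^ (2 * j) ∂μ else 0) := by
    intro ζ
    obtain ⟨H, hHhom, hHlap, hHtop, hdec⟩ := he (fun i => ζ i)
    have hpt : ∀ y : V, ⟪y, ζ⟫ ^ k = ∑ j ∈ Finset.range (k / 2 + 1),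
        ‖y‖ ^ (2 * j) * eval (fun i => y i) (H j) := by
      intro y
      rw [inner_eq_eval_linForm, ← map_pow, hdec, map_sum]
      refine Finset.sum_congr rfl fun j _ => ?_
      rw [map_mul, map_pow, eval_rsq, ← pow_mul]
    simp_rw [hpt]
    rw [integral_finsetSum _ fun j _ => hint (H j) (k - 2 * j) j (hHhom j)]
    refine Finset.sum_congr rfl fun j hj => ?_
    by_cases h2 : 2 * j = k
    · rw [if_pos h2, hHtop j h2]
      have hζ : (∑ i, (ζ i) ^ 2) = ‖ζ‖ ^ 2 := by
        rw [EuclideanSpace.norm_sq_eq]; simp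
      simp only [eval_C]
      rw [← integral_const_mul, ← hζ]
      refine integral_congr_ae (ae_of_all _ fun y => ?_)
      simp only; ring
    · rw [if_neg h2]
      have hjk : 2 * j ≤ k := by have := Finset.mem_range.1 hj; omega
      exact hharm (k - 2 * j) j (H j) (by omega) (hHhom j) (hHlap j)
  rw [hval ξ, hval ξ', hξ]

/-! ## Growth of `‖y‖^{2j} P(y)` against the exponential weight -/

/-- For `P` homogeneous of degree `n` and `c > 0`: `|‖y‖^{2j} P(y)| ≤ A e^{(c/2)‖y‖}` and
`(‖y‖^{2j} P(y))² ≤ A' e^{(c/2)‖y‖}` for suitable constants. -/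
theorem growth_bounds {P : MvPolynomial (Fin 3) ℝ} {n : ℕ} (hP : P.IsHomogeneous n) (j : ℕ)
    {c : ℝ} (hc : 0 < c) :
    ∃ A A' : ℝ, (∀ y : V, |‖y‖ ^ (2 * j) * eval (fun i => y i) P| ≤ A * Real.exp (c / 2 * ‖y‖)) ∧
      ∀ y : V, (‖y‖ ^ (2 * j) * eval (fun i => y i) P) ^ 2 ≤ A' * Real.exp (c / 2 * ‖y‖) := by
  obtain ⟨CP, hCP0, hCP⟩ := abs_eval_ofLp_le_of_isHomogeneous hP
  have hg : ∀ y : V, |‖y‖ ^ (2 * j) * eval (fun i => y i) P| ≤ CP * ‖y‖ ^ (2 * j + n) := by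
    intro y
    rw [abs_mul, abs_of_nonneg (by positivity), pow_add]
    calc ‖y‖ ^ (2 * j) * |eval (fun i => y i) P| ≤ ‖y‖ ^ (2 * j) * (CP * ‖y‖ ^ n) :=
          mul_le_mul_of_nonneg_left (hCP y) (by positivity)
      _ = CP * (‖y‖ ^ (2 * j) * ‖y‖ ^ n) := by ring
  refine ⟨CP * (((2 * j + n).factorial : ℝ) * (2 / c) ^ (2 * j + n)),
    CP ^ 2 * (((2 * (2 * j + n)).factorial : ℝ) * (2 / c) ^ (2 * (2 * j + n))),
    fun y => ?_, fun y => ?_⟩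
  · have h := IsingInputs.pow_le_factorial_mul_exp hc (2 * j + n) (norm_nonneg y)
    calc |‖y‖ ^ (2 * j) * eval (fun i => y i) P| ≤ CP * ‖y‖ ^ (2 * j + n) := hg y
      _ ≤ CP * (((2 * j + n).factorial : ℝ) * (2 / c) ^ (2 * j + n) * Real.exp (c / 2 * ‖y‖)) :=
          mul_le_mul_of_nonneg_left h hCP0
      _ = _ := by ring
  · have h := IsingInputs.pow_le_factorial_mul_exp hc (2 * (2 * j + n)) (norm_nonneg y)
    have hsq : (‖y‖ ^ (2 * j) * eval (fun i => y i) P) ^ 2 ≤ CP ^ 2 * ‖y‖ ^ (2 * (2 * j + n)) := by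
      have := hg y
      calc (‖y‖ ^ (2 * j) * eval (fun i => y i) P) ^ 2 = |‖y‖ ^ (2 * j) * eval (fun i => y i) P| ^ 2 :=
            (sq_abs _).symm
        _ ≤ (CP * ‖y‖ ^ (2 * j + n)) ^ 2 := pow_le_pow_left₀ (abs_nonneg _) this 2
        _ = CP ^ 2 * ‖y‖ ^ (2 * (2 * j + n)) := by rw [mul_pow, ← pow_mul, mul_comm (2 * j + n)]
    calc (‖y‖ ^ (2 * j) * eval (fun i => y i) P) ^ 2 ≤ CP ^ 2 * ‖y‖ ^ (2 * (2 * j + n)) := hsq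
      _ ≤ CP ^ 2 * (((2 * (2 * j + n)).factorial : ℝ) * (2 / c) ^ (2 * (2 * j + n)) *
          Real.exp (c / 2 * ‖y‖)) := mul_le_mul_of_nonneg_left h (sq_nonneg _)
      _ = _ := by ring

/-- Integrability of `‖y‖^{2j} P(y)` (homogeneous `P`) under an exponential moment. -/
theorem integrable_poly_of_exp_moment {μ : Measure V} {c : ℝ} (hc : 0 < c)
    (hμ : Integrable (fun y : V => Real.exp (c / 2 * ‖y‖)) μ)
    (P : MvPolynomial (Fin 3) ℝ) (n j : ℕ) (hP : P.IsHomogeneous n) :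
    Integrable (fun y : V => ‖y‖ ^ (2 * j) * eval (fun i => y i) P) μ := by
  obtain ⟨A, -, hA, -⟩ := growth_bounds hP j hc
  refine (hμ.const_mul A).mono' ?_ (ae_of_all _ fun y => by rw [Real.norm_eq_abs]; exact hA y)
  refine ((continuous_norm.pow _).mul ?_).aestronglyMeasurable
  exact (continuous_eval P).comp (by fun_prop : Continuous fun y : V => fun i => y i)

/-! ## Asymptotic rotation invariance of the scaled two-point measures -/

/-- **Asymptotic `O(3)`-invariance of `ν_β` as `β ↑ β_c`.** Assume subcritical harmonic dilution
(the route's `HarmonicDilution` formula: every anisotropy ratio `a_{Y,m}(β) → 0`) and the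
one-length window CLW (ii) (uniform exponential moments). Then for every bounded continuous test
function `ψ` on Euclidean `ℝ³` and every linear isometry `T`,
`∫ ψ∘T dν_β - ∫ ψ dν_β → 0` as `β ↑ β_c`.
Proof: along any sequence `β_j ↑ β_c` a subsequence of `ν_{β_j}` converges weakly (Prokhorov, the
exponential moments are uniform); moments pass to the limit, so the limit kills every
`‖y‖^{2m}Y(y)`; by the Fischer decomposition its marginal moments are radial, and by moment
determinacy under an exponential moment it is `T`-invariant. -/
theorem asymptotic_invariance
    (hHD : ∀ (n m : ℕ) (Y : MvPolynomial (Fin 3) ℝ), 1 ≤ n → Y.IsHomogeneous n →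
      (∑ i : Fin 3, pderiv i (pderiv i Y)) = 0 →
      Tendsto (fun β => (∑' x : Site 3, eval (fun i => ((x i : ℤ) : ℝ)) Y *
          Real.sqrt (∑ i, ((x i : ℤ) : ℝ) ^ 2) ^ (2 * m) * twoPointFree 3 β x) /
        (∑' x : Site 3, Real.sqrt (∑ i, ((x i : ℤ) : ℝ) ^ 2) ^ (n + 2 * m) * twoPointFree 3 β x))
        (𝓝[<] (criticalBeta 3)) (𝓝 0))
    {c₀ C β₀ : ℝ} (hc₀ : 0 < c₀) (hβ₀ : β₀ < criticalBeta 3)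
    (hii : ∀ β : ℝ, β₀ ≤ β → β < criticalBeta 3 → ∀ A : ℝ, 1 ≤ A →
      (∑' x : Site 3, if A ^ 2 * msq β < (∑ i, ((x i : ℤ) : ℝ) ^ 2) * chi β
        then twoPointFree 3 β x else 0) ≤ C * Real.exp (-(c₀ * A)) * chi β)
    (ψ : V → ℝ) (hψc : Continuous ψ) {Bψ : ℝ} (hψb : ∀ y, |ψ y| ≤ Bψ) (T : V ≃ₗᵢ[ℝ] V) :
    Tendsto (fun β => (∫ y, ψ (T y) ∂(nu β)) - ∫ y, ψ y ∂(nu β)) (𝓝[<] (criticalBeta 3))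
      (𝓝 0) := by
  classical
  obtain ⟨K, hK⟩ := nu_exp_moment hc₀ hii
  set βs : ℝ := max β₀ 0 with hβs_def
  have hβs : βs < criticalBeta 3 := max_lt hβ₀ (criticalBeta_pos_holds (d := 3) (by norm_num))
  -- bounded continuous versions of `ψ` and `ψ ∘ T`
  set fψ : V →ᵇ ℝ := BoundedContinuousFunction.ofNormedAddCommGroup ψ hψc Bψ
    (fun y => by rw [Real.norm_eq_abs]; exact hψb y) with hfψ
  set fψT : V →ᵇ ℝ := BoundedContinuousFunction.ofNormedAddCommGroup (fun y => ψ (T y))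
    (hψc.comp T.continuous) Bψ (fun y => by rw [Real.norm_eq_abs]; exact hψb (T y)) with hfψT
  refine tendsto_of_subseq_tendsto fun ns hns => ?_
  -- eventually the sequence is in the good range
  have hev : ∀ᶠ j in atTop, ns j ∈ Ioo βs (criticalBeta 3) := hns.eventually (Ioo_mem_nhdsLT hβs)
  obtain ⟨J, hJ⟩ := eventually_atTop.1 hev
  have hgood : ∀ j, βs < ns (J + j) ∧ ns (J + j) < criticalBeta 3 := fun j => hJ _ (by omega)
  have hpos : ∀ j, 0 < ns (J + j) := fun j => lt_of_le_of_lt (le_max_right _ _) (hgood j).1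
  have hge : ∀ j, β₀ ≤ ns (J + j) := fun j => (le_max_left _ _).trans (hgood j).1.le
  -- the probability measures
  set μs : ℕ → ProbabilityMeasure V := fun j =>
    ⟨nu (ns (J + j)), isProbabilityMeasure_nu (hpos j).le (hgood j).2⟩ with hμs
  have hμs_coe : ∀ j, ((μs j : ProbabilityMeasure V) : Measure V) = nu (ns (J + j)) := fun j => rfl
  have hexp : ∀ j, Integrable (fun y : V => Real.exp (c₀ / 2 * ‖y‖)) (μs j : Measure V) ∧
      ∫ y, Real.exp (c₀ / 2 * ‖y‖) ∂(μs j : Measure V) ≤ K := fun j =>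
    hK _ (hge j) (hpos j) (hgood j).2
  have hc2 : 0 < c₀ / 2 := by positivity
  obtain ⟨μ, φ', hφ', hlimμ⟩ := WeakLimit.exists_subseq_tendsto_of_exp_moment hc2
    (fun j => (hexp j).1) (fun j => (hexp j).2)
  obtain ⟨hintμ, hKμ⟩ := WeakLimit.exp_moment_le_of_tendsto hlimμ (fun j => (hexp (φ' j)).1)
    (fun j => (hexp (φ' j)).2)
  -- the subsequence of inverse temperatures still tends to `β_c⁻`
  have hsub : Tendsto (fun j => ns (J + φ' j)) atTop (𝓝[<] (criticalBeta 3)) := by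
    refine hns.comp ?_
    exact tendsto_atTop_mono (fun j => Nat.le_add_left _ _) hφ'.tendsto_atTop
  -- (1) the weak limit kills all harmonic moments
  have hharmμ : ∀ (n m : ℕ) (Y : MvPolynomial (Fin 3) ℝ), 1 ≤ n → Y.IsHomogeneous n →
      (∑ i : Fin 3, pderiv i (pderiv i Y)) = 0 →
      ∫ y, ‖y‖ ^ (2 * m) * eval (fun i => y i) Y ∂(μ : Measure V) = 0 := by
    intro n m Y hn hY hlap
    set g : V → ℝ := fun y => eval (fun i => y i) Y * ‖y‖ ^ (2 * m) with hg
    have hgc : Continuous g :=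
      ((continuous_eval Y).comp (by fun_prop : Continuous fun y : V => fun i => y i)).mul
        (continuous_norm.pow _)
    obtain ⟨-, A', -, hA'⟩ := growth_bounds hY m hc₀
    have hA'' : ∀ y : V, g y ^ 2 ≤ A' * Real.exp (c₀ / 2 * ‖y‖) := fun y => by
      rw [hg]; dsimp only; rw [mul_comm]; exact hA' y
    -- moments converge along the subsequence
    have h1 : Tendsto (fun j => ∫ y, g y ∂(μs (φ' j) : Measure V)) atTop
        (𝓝 (∫ y, g y ∂(μ : Measure V))) :=
      WeakLimit.tendsto_integral_of_sq_le_exp_moment hlimμ hgc hA''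
        (fun j => (hexp (φ' j)).1) (fun j => (hexp (φ' j)).2) hintμ hKμ
    -- and they tend to zero by harmonic dilution
    set q : ℕ := n + 2 * m with hq
    have hradial_bd : ∀ j, |∫ y, ‖y‖ ^ q ∂(μs (φ' j) : Measure V)| ≤
        (q.factorial : ℝ) * (2 / c₀) ^ q * K := by
      intro j
      have hnn : 0 ≤ ∫ y, ‖y‖ ^ q ∂(μs (φ' j) : Measure V) := integral_nonneg fun y => by positivity
      rw [abs_of_nonneg hnn]
      calc ∫ y, ‖y‖ ^ q ∂(μs (φ' j) : Measure V)
          ≤ ∫ y, (q.factorial : ℝ) * (2 / c₀) ^ q * Real.exp (c₀ / 2 * ‖y‖) ∂(μs (φ' j) : Measure V) := by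
            refine integral_mono_of_nonneg (ae_of_all _ fun y => by positivity)
              ((hexp (φ' j)).1.const_mul _) (ae_of_all _ fun y => ?_)
            exact IsingInputs.pow_le_factorial_mul_exp hc₀ q (norm_nonneg y)
        _ = (q.factorial : ℝ) * (2 / c₀) ^ q * ∫ y, Real.exp (c₀ / 2 * ‖y‖) ∂(μs (φ' j) : Measure V) :=
            integral_const_mul _ _
        _ ≤ (q.factorial : ℝ) * (2 / c₀) ^ q * K :=
            mul_le_mul_of_nonneg_left (hexp (φ' j)).2 (by positivity)
    have h2 : Tendsto (fun j => ∫ y, g y ∂(μs (φ' j) : Measure V)) atTop (𝓝 0) := by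
      have ha := (hHD n m Y hn hY hlap).comp hsub
      have heq : ∀ j, ∫ y, g y ∂(μs (φ' j) : Measure V) =
          (∑' x : Site 3, eval (fun i => ((x i : ℤ) : ℝ)) Y *
              Real.sqrt (∑ i, ((x i : ℤ) : ℝ) ^ 2) ^ (2 * m) * twoPointFree 3 (ns (J + φ' j)) x) /
            (∑' x : Site 3, Real.sqrt (∑ i, ((x i : ℤ) : ℝ) ^ 2) ^ (n + 2 * m) *
              twoPointFree 3 (ns (J + φ' j)) x) *
          ∫ y, ‖y‖ ^ q ∂(μs (φ' j) : Measure V) := fun j =>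
        integral_harmonicMoment_eq (hpos (φ' j)).le (hgood (φ' j)).2 hn hY m
      refine squeeze_zero_norm (fun j => ?_) ?_ (a := fun j =>
        ‖(∑' x : Site 3, eval (fun i => ((x i : ℤ) : ℝ)) Y *
              Real.sqrt (∑ i, ((x i : ℤ) : ℝ) ^ 2) ^ (2 * m) * twoPointFree 3 (ns (J + φ' j)) x) /
            (∑' x : Site 3, Real.sqrt (∑ i, ((x i : ℤ) : ℝ) ^ 2) ^ (n + 2 * m) *
              twoPointFree 3 (ns (J + φ' j)) x)‖ * ((q.factorial : ℝ) * (2 / c₀) ^ q * K))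
      · rw [heq j, norm_mul]
        exact mul_le_mul_of_nonneg_left (by rw [Real.norm_eq_abs]; exact hradial_bd j) (norm_nonneg _)
      · have := ha.norm.mul_const ((q.factorial : ℝ) * (2 / c₀) ^ q * K)
        simpa using this
    have h3 := tendsto_nhds_unique h1 h2
    rw [hg] at h3
    rw [← h3]
    exact integral_congr_ae (ae_of_all _ fun y => by simp only; ring)
  -- (2) hence the marginal moments of the limit are radial, and the limit is `T`-invariant
  haveI : IsProbabilityMeasure (μ : Measure V) := μ.prop
  have hrad : ∀ ξ ξ' : V, ‖ξ‖ = ‖ξ'‖ → ∀ k : ℕ,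
      ∫ y, ⟪y, ξ⟫ ^ k ∂(μ : Measure V) = ∫ y, ⟪y, ξ'⟫ ^ k ∂(μ : Measure V) :=
    fun ξ ξ' h k => inner_moments_radial (integrable_poly_of_exp_moment hc₀ hintμ) hharmμ ξ ξ' h k
  have hinv : (μ : Measure V).map T = μ :=
    Determinacy.map_linearIsometryEquiv_eq_self_of_radial_moments hc2 hintμ hrad T
  -- (3) conclusion along the subsequence
  refine ⟨fun j => J + φ' j, ?_⟩
  have hconvT := (ProbabilityMeasure.tendsto_iff_forall_integral_tendsto.1 hlimμ) fψT
  have hconv := (ProbabilityMeasure.tendsto_iff_forall_integral_tendsto.1 hlimμ) fψ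
  have hTint : ∫ y, ψ (T y) ∂(μ : Measure V) = ∫ y, ψ y ∂(μ : Measure V) := by
    conv_rhs => rw [← hinv]
    rw [integral_map T.continuous.measurable.aemeasurable hψc.aestronglyMeasurable]
  have h := hconvT.sub hconv
  simp only [hfψT, hfψ, BoundedContinuousFunction.coe_ofNormedAddCommGroup, hTint, sub_self] at h
  exact h

end Summit.CriticalPhenomena.Ising3DConformalLimit.Theorems.HarmonicMomentsIsotropy

end
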